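import Summits.CriticalPhenomena.PercolationContinuityZ3.Theorems.FK.BoundaryWiringClusterCount
import Summits.CriticalPhenomena.PercolationContinuityZ3.Theorems.FK.PartitionFunctionQDerivative
import HarnessLib

/-!
# FK-continuity cell, FO-10a: Grimmett 2006 (4.80)–(4.84) as printed — the `q`-derivatives of the finite-volume
# pressures CONVERGE: to the right derivative `Φ'(q+) = κ⁰/q` of the pressure for free boundary conditions, to the left
# derivative `Φ'(q−) = κ¹/q` for wired ones, and to `Φ'(q)` for EVERY one-class boundary wiring at points of
# `q`-differentiability

Registered R109 (cell INBOX l.7500, 2026-08-25); registry row FO-10a-g341; label CCL-F (coordinator fk-4 g227).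
Cell `fk-continuity` (bschramm), row FO-10a (pressure layer); support file for the FK-continuity transplant
(`--supports stmt-CriticalPhenomena-4575`); builds on p205010 (kernel theorem, internal audit signed; external expert
review pending). Pure proofs; no definitions, no named facts, no sorries; `d ≥ 1`.
UNCONDITIONAL finite- and infinite-volume structure; it decides nothing about FH / TP_FK / the value of `p_c(q)`.

Grimmett's (4.80): "by the convexity of `G^ξ_Λ` in `κ`, `dG^ξ_Λ/dκ → dG/dκ` as `Λ ↑ ℤ^d`, for `κ ∉ 𝒟''_π`", and (4.82)/(4.84):
the free and wired derivatives bracket every other and tend to `d⁻¹ φ^{0/1}_{p,q}(|C_0|⁻¹)`. In the tree's per-site,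
`q`-variable normalisation (`PressureQDerivatives`: `Φ'(q+) = κ⁰(p,q)/q`, `Φ'(q−) = κ¹(p,q)/q`), with
`F^B_N(r) = |Λ_N|⁻¹ log Z^B_{Λ_N}(p,r)` and `∂_q F^B_N(q) = |Λ_N|⁻¹ E^B_{Λ_N,p,q}[k^B]/q` (`PartitionFunctionQDerivative`),
the two-sided cluster-count limits of `BoxClusterCountFreeLimit` / `BoxClusterCountWiredLimit` /
`BoundaryWiringClusterCount` give, for `d ≥ 1`, `0 ≤ p ≤ 1`, `q ≥ 1`:

* **`tendsto_deriv_boxPressure_q`** — `∂_q F^b_N(q) → κ^b(p,q)/q` for `b ∈ {free, wired}` (no hypothesis on `Φ`);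
* **`exists_tendsto_deriv_boxPressure_false_and_hasDerivWithinAt_Ioi`** / **`…_true_…_Iio`** — (4.84) with (4.80): if the
  per-site pressures converge to `Φ` near `q` (Thm. (4.58), `PressureThermodynamicLimit`), then
  `lim_N ∂_q F⁰_N(q) = Φ'(q+)` and `lim_N ∂_q F¹_N(q) = Φ'(q−)` (`0 < p < 1`);
* `eventually_deriv_boxPressure_wiring_le` / `eventually_le_deriv_boxPressure_wiring` — for every sequence of wired classes
  `B_N ⊆ ∂Λ_N` and `ε > 0`, eventually `κ¹/q − ε ≤ ∂_q F^{B_N}_N(q) ≤ κ⁰/q + ε` ((4.81)–(4.82));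
* **`tendsto_deriv_boxPressure_wiring_of_rcLimit_eq`** — under uniqueness `φ⁰_{p,q} = φ¹_{p,q}`,
  `∂_q F^{B_N}_N(q) → κ⁰/q` along EVERY `B_N ⊆ ∂Λ_N`;
* **`tendsto_deriv_boxPressure_wiring_of_differentiableAt`** — (4.80) verbatim: if `Φ(p,·)` is differentiable at `q > 1`
  then `∂_q F^{B_N}_N(q) → Φ'(q)` along every `B_N ⊆ ∂Λ_N` (`0 < p < 1`; Lemma (4.79) `differentiableAt_pressure_q_iff`).

## References

* G. Grimmett, *The Random-Cluster Model*, Springer 2006 (`book:grimmett2006-random-cluster-model`): §4.5 Thm. (4.58),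
  (4.71)–(4.72), Lemma (4.79), (4.80)–(4.84) [PDF pp. 92–95]. [Grimmett2006]
-/

noncomputable section

open scoped Classical
open Finset Filter Topology MeasureTheory

namespace Summit.CriticalPhenomena.PercolationContinuityZ3.Theorems.FK

open Literature.Probability.Percolation Literature.Probability.LatticeModels

variable {d : ℕ} {p q : ℝ}

/-! ### Free and wired: the finite-volume `q`-derivatives converge to `κ^b/q` -/

section FreeWired

/-- **`∂_q (|Λ_N|⁻¹ log Z^b_{Λ_N}(p,q)) → κ^b(p,q)/q`** for the free (`b = false`) and wired (`b = true`) box measures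
(`d ≥ 1`, `0 ≤ p ≤ 1`, `q ≥ 1`; `κ^b(p,q) = ∫ |C_0|⁻¹ dφ^b_{p,q}`). [cite: Grimmett2006, (4.72), (4.82)–(4.84)] -/
theorem tendsto_deriv_boxPressure_q (hd : 0 < d) (hp : p ∈ Set.Icc (0 : ℝ) 1) (hq : 1 ≤ q) (b : Bool) :
    Tendsto (fun N : ℕ => deriv (fun r => Real.log (rcPartitionFunction (finsetGraph (zdGraph d) (box d N)) p r
        (boxBC d b N)) / #(box d N)) q) atTop
      (𝓝 ((∫ ω, ((openCluster ω (0 : Site d)).ncard : ℝ)⁻¹ ∂(rcLimit d b p q)) / q)) := by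
  have hq0 : 0 < q := one_pos.trans_le hq
  have hlim : Tendsto (fun N => rcExpect (finsetGraph (zdGraph d) (box d N)) p q (boxBC d b N)
      (fun ω => (clusterCount (↑ω : BondConfig ↥(box d N)) (boxBC d b N) : ℝ)) / #(box d N)) atTop
      (𝓝 (∫ ω, ((openCluster ω (0 : Site d)).ncard : ℝ)⁻¹ ∂(rcLimit d b p q))) := by
    cases b
    · exact tendsto_rcExpect_clusterCount_div_card_box_false hd hp hq
    · exact tendsto_rcExpect_clusterCount_div_card_box_true hd hp hq
  refine (hlim.div_const q).congr fun N => ?_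
  rw [deriv_log_rcPartitionFunction_box_div_q hp hq0 (boxBC d b N)]

/-- **(4.84) with (4.80), free boundary condition: the `q`-derivatives of the finite-volume free pressures converge to the
RIGHT `q`-derivative of the pressure, `lim_N ∂_q F⁰_N(q) = Φ'(q+)`** (`d ≥ 1`, `0 < p < 1`, `q ≥ 1`; hypothesis: the per-site
pressures of both boundary conditions converge to `Φ` near `q`, Thm. (4.58)). [cite: Grimmett2006, (4.80), (4.84)] -/
theorem exists_tendsto_deriv_boxPressure_false_and_hasDerivWithinAt_Ioi (hd : 0 < d) (hp : p ∈ Set.Ioo (0 : ℝ) 1)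
    (hq : 1 ≤ q) {Φ : ℝ → ℝ}
    (hΦ : ∀ b : Bool, ∀ᶠ y in 𝓝 q, Tendsto (fun N : ℕ =>
      Real.log (rcPartitionFunction (finsetGraph (zdGraph d) (box d N)) p y (boxBC d b N)) / #(box d N)) atTop (𝓝 (Φ y))) :
    ∃ D : ℝ, Tendsto (fun N : ℕ => deriv (fun r => Real.log (rcPartitionFunction (finsetGraph (zdGraph d) (box d N)) p r
        (boxBC d false N)) / #(box d N)) q) atTop (𝓝 D) ∧ HasDerivWithinAt Φ D (Set.Ioi q) q :=
  ⟨_, tendsto_deriv_boxPressure_q hd ⟨hp.1.le, hp.2.le⟩ hq false, hasDerivWithinAt_pressure_q_Ioi hd hp hq hΦ⟩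

/-- **(4.84) with (4.80), wired boundary condition: the `q`-derivatives of the finite-volume wired pressures converge to
the LEFT `q`-derivative of the pressure, `lim_N ∂_q F¹_N(q) = Φ'(q−)`** (`d ≥ 1`, `0 < p < 1`, `q > 1`).
[cite: Grimmett2006, (4.80), (4.84)] -/
theorem exists_tendsto_deriv_boxPressure_true_and_hasDerivWithinAt_Iio (hd : 0 < d) (hp : p ∈ Set.Ioo (0 : ℝ) 1)
    (hq : 1 < q) {Φ : ℝ → ℝ}
    (hΦ : ∀ b : Bool, ∀ᶠ y in 𝓝 q, Tendsto (fun N : ℕ =>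
      Real.log (rcPartitionFunction (finsetGraph (zdGraph d) (box d N)) p y (boxBC d b N)) / #(box d N)) atTop (𝓝 (Φ y))) :
    ∃ D : ℝ, Tendsto (fun N : ℕ => deriv (fun r => Real.log (rcPartitionFunction (finsetGraph (zdGraph d) (box d N)) p r
        (boxBC d true N)) / #(box d N)) q) atTop (𝓝 D) ∧ HasDerivWithinAt Φ D (Set.Iio q) q :=
  ⟨_, tendsto_deriv_boxPressure_q hd ⟨hp.1.le, hp.2.le⟩ hq.le true, hasDerivWithinAt_pressure_q_Iio hd hp hq hΦ⟩

end FreeWired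

/-! ### Arbitrary one-class boundary wirings `B_N ⊆ ∂Λ_N` -/

section Wiring

/-- **(4.81)–(4.82), upper half: for every sequence of wired classes `B_N` and `ε > 0`, eventually
`∂_q F^{B_N}_N(q) ≤ κ⁰(p,q)/q + ε`** (`d ≥ 1`, `0 ≤ p ≤ 1`, `q ≥ 1`). [cite: Grimmett2006, (4.81)–(4.82)] -/
theorem eventually_deriv_boxPressure_wiring_le (hd : 0 < d) (hp : p ∈ Set.Icc (0 : ℝ) 1) (hq : 1 ≤ q)
    (B : ∀ N : ℕ, Set ↥(box d N)) {ε : ℝ} (hε : 0 < ε) :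
    ∀ᶠ N : ℕ in atTop, deriv (fun r => Real.log (rcPartitionFunction (finsetGraph (zdGraph d) (box d N)) p r (B N)) /
        #(box d N)) q ≤ (∫ ω, ((openCluster ω (0 : Site d)).ncard : ℝ)⁻¹ ∂(rcLimit d false p q)) / q + ε := by
  have hq0 : 0 < q := one_pos.trans_le hq
  filter_upwards [eventually_rcExpect_clusterCount_false_div_le hd hp hq (show 0 < ε * q by positivity)] with N hN
  rw [deriv_log_rcPartitionFunction_box_div_q hp hq0 (B N)]
  have h := div_le_div_of_nonneg_right (rcExpect_clusterCount_le_false hp hq (B N)) (Nat.cast_nonneg (#(box d N)))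
  rw [div_le_iff₀ hq0, add_mul, div_mul_cancel₀ _ hq0.ne']
  linarith

/-- **(4.81)–(4.82), lower half: for every sequence of wired classes `B_N ⊆ ∂Λ_N` and `ε > 0`, eventually
`κ¹(p,q)/q − ε ≤ ∂_q F^{B_N}_N(q)`** (`d ≥ 1`, `0 ≤ p ≤ 1`, `q ≥ 1`). [cite: Grimmett2006, (4.81)–(4.82)] -/
theorem eventually_le_deriv_boxPressure_wiring (hd : 0 < d) (hp : p ∈ Set.Icc (0 : ℝ) 1) (hq : 1 ≤ q)
    {B : ∀ N : ℕ, Set ↥(box d N)} (hB : ∀ N, B N ⊆ boxBC d true N) {ε : ℝ} (hε : 0 < ε) :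
    ∀ᶠ N : ℕ in atTop, (∫ ω, ((openCluster ω (0 : Site d)).ncard : ℝ)⁻¹ ∂(rcLimit d true p q)) / q - ε ≤
      deriv (fun r => Real.log (rcPartitionFunction (finsetGraph (zdGraph d) (box d N)) p r (B N)) / #(box d N)) q := by
  have hq0 : 0 < q := one_pos.trans_le hq
  filter_upwards [eventually_le_sum_rcExpect_ite_inv_ncard_true_div hd hp hq (show 0 < ε * q by positivity)] with N hN
  rw [deriv_log_rcPartitionFunction_box_div_q hp hq0 (B N)]
  have h := div_le_div_of_nonneg_right (sum_rcExpect_ite_true_le_rcExpect_clusterCount hp hq (hB N))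
    (Nat.cast_nonneg (#(box d N)))
  rw [le_div_iff₀ hq0, sub_mul, div_mul_cancel₀ _ hq0.ne']
  linarith

/-- **Under uniqueness `φ⁰_{p,q} = φ¹_{p,q}`: `∂_q F^{B_N}_N(q) → κ⁰(p,q)/q` along EVERY sequence of wired classes
`B_N ⊆ ∂Λ_N`** (`d ≥ 1`, `0 ≤ p ≤ 1`, `q ≥ 1`). [cite: Grimmett2006, (4.80)–(4.84) with Lemma (4.79)] -/
theorem tendsto_deriv_boxPressure_wiring_of_rcLimit_eq (hd : 0 < d) (hp : p ∈ Set.Icc (0 : ℝ) 1) (hq : 1 ≤ q)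
    {B : ∀ N : ℕ, Set ↥(box d N)} (hB : ∀ N, B N ⊆ boxBC d true N) (huniq : rcLimit d false p q = rcLimit d true p q) :
    Tendsto (fun N : ℕ => deriv (fun r => Real.log (rcPartitionFunction (finsetGraph (zdGraph d) (box d N)) p r (B N)) /
        #(box d N)) q) atTop (𝓝 ((∫ ω, ((openCluster ω (0 : Site d)).ncard : ℝ)⁻¹ ∂(rcLimit d false p q)) / q)) := by
  have hq0 : 0 < q := one_pos.trans_le hq
  refine ((tendsto_rcExpect_clusterCount_div_card_box_of_rcLimit_eq hd hp hq hB huniq).div_const q).congr fun N => ?_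
  rw [deriv_log_rcPartitionFunction_box_div_q hp hq0 (B N)]

/-- **Grimmett's (4.80) for every one-class boundary wiring: if the pressure `Φ(p,·)` is differentiable at `q` then
`∂_q F^{B_N}_N(q) → Φ'(q)` along EVERY sequence of wired classes `B_N ⊆ ∂Λ_N`** (`d ≥ 1`, `0 < p < 1`, `q > 1`; hypothesis:
the per-site pressures converge to `Φ` near `q`, Thm. (4.58); differentiability forces `φ⁰_{p,q} = φ¹_{p,q}`, Lemma (4.79)).
[cite: Grimmett2006, (4.80) with Lemma (4.79) and (4.84)] -/
theorem tendsto_deriv_boxPressure_wiring_of_differentiableAt (hd : 0 < d) (hp : p ∈ Set.Ioo (0 : ℝ) 1) (hq : 1 < q)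
    {Φ : ℝ → ℝ}
    (hΦ : ∀ b : Bool, ∀ᶠ y in 𝓝 q, Tendsto (fun N : ℕ =>
      Real.log (rcPartitionFunction (finsetGraph (zdGraph d) (box d N)) p y (boxBC d b N)) / #(box d N)) atTop (𝓝 (Φ y)))
    (hdiff : DifferentiableAt ℝ Φ q) {B : ∀ N : ℕ, Set ↥(box d N)} (hB : ∀ N, B N ⊆ boxBC d true N) :
    Tendsto (fun N : ℕ => deriv (fun r => Real.log (rcPartitionFunction (finsetGraph (zdGraph d) (box d N)) p r (B N)) /
        #(box d N)) q) atTop (𝓝 (deriv Φ q)) := by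
  have hp' : p ∈ Set.Icc (0 : ℝ) 1 := ⟨hp.1.le, hp.2.le⟩
  have huniq : rcLimit d false p q = rcLimit d true p q := (differentiableAt_pressure_q_iff hd hp hq hΦ).1 hdiff
  have hD : deriv Φ q = (∫ ω, ((openCluster ω (0 : Site d)).ncard : ℝ)⁻¹ ∂(rcLimit d false p q)) / q :=
    (uniqueDiffWithinAt_Ioi q).eq_deriv _ hdiff.hasDerivAt.hasDerivWithinAt
      (hasDerivWithinAt_pressure_q_Ioi hd hp hq.le hΦ)
  rw [hD]
  exact tendsto_deriv_boxPressure_wiring_of_rcLimit_eq hd hp' hq.le hB huniq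

end Wiring

end Summit.CriticalPhenomena.PercolationContinuityZ3.Theorems.FK

end
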